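import Summits.BirchSwinnertonDyer.BirchSwinnertonDyer.Theorems.EisensteinPrimesLineCharactersWeilRelation
import Summits.BirchSwinnertonDyer.Rank1Residual.X2.IsogenyQuotientLine
import Literature.NumberTheory.EllipticCurves.Rank1Residual.GVParityIsogenyClassProofs
import Literature.NumberTheory.EllipticCurves.GreenbergVatsal2000.NonPrimitiveSelmerGroup
import Literature.NumberTheory.EllipticCurves.ShafarevichGoodReductionBadPlacesProofs
import Literature.NumberTheory.EllipticCurves.ComplexMultiplicationLFunctionIsogenyHoldsProofs
import HarnessLib

/-!
# Crux 3 `MazurMCOnCellB` (stmt-BirchSwinnertonDyer-19033), line `twistback` v11/v12 — lane ISO-2: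
# THE SUB-ROW DATUM IS A CLASS DATUM (it is constant on `ℚ`-isogeny classes)

Width seat bsd-line-x2-p1-w7 (gen 4), cell `bsd-eis` (run/shared/lean/pub/bsd-eis/), 2026-08-29. Sequel of this
lineage's `…LineCharactersWeilRelation` (w7 g0: the Weil relation `φ·ψ = ω` for the Dirichlet presentations of a
rational `p`-line) and `…TwistbackIsogenyTransport` / `…TwistbackSubrowCell<member>` (w7 g3: the sub-row datum
kernel-checked at all 76 Cremona curves of the 30 A10 sub-row classes, the SAME balance on every member, 46/46).
HONEST FRAMING: TOOL THEOREMS ONLY (no `def`, no named fact, no `sorry`); every input a tree THEOREM; `--supports`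
stmt-BirchSwinnertonDyer-19033; closes no stub; no summit statement, no Mazur main conjecture, no BSD is proved for any
curve; 0 cells / labels / stubs / tiers move.

WHY. The registered stub of the line (v5 … v12) is asked OFF the closed sub-row: its first negated hypothesis is
the SUB-ROW DATUM «`p = 3`, `3` non-split, and a rational `3`-line `Φ₀` with PRIMITIVE Dirichlet presentations
`φ` mod `m` (on `Φ₀`) and `ψ` mod `d` (on `E[3]/Φ₀`), a finite set `S₀` of places `∌ 3` off which `E` is good, of
Greenberg–Vatsal local balance `1 + Σ_{v ∈ S₀} δ_E^{(v)} = Σ_{v ∈ S₀} (s_v·[φ(ℓ_v) = ℓ̄_v] + s_v·[ψ(ℓ_v) = ℓ̄_v])`».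
LEAD g15 (bus 22:43:02Z): «widening the sub-row exclusion to an isogenous member — mathematically idle IF the
balance datum is isogeny-invariant». This file proves the IF, for every `ℚ`-isogeny class (all conductors):

* §1 (any prime `p`, any `Γ_ℚ`-equivariant `g : E[p] → E′[p]` with `ker g ≠ E[p]`) — **line-datum transfer**:
  from a rational line `Φ₀ ≤ E[p]` with presentations `(m, φ)` on the line and `(d, ψ)` on the quotient, a rational
  line `Λ ≤ E′[p]` with presentations `(m, φ), (d, ψ)` KEPT (`ker g = 0`, or `ker g` a line `≠ Φ₀`) or SWAPPED
  (`ker g = Φ₀`: then `Λ = g(E[p]) ≅ E[p]/Φ₀`). The sub-character on `Λ` is read off `g`; the quotient character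
  is FORCED by the determinant: `det ρ̄_{E′,p} = χ_p` on the stable line `Λ`
  (`…StubB1LineDeterminant.smul_sub_nsmul_mem_of_smul_sub_eq`) and `φ(χ_m σ)·ψ(χ_d σ) = χ_p(σ)` on `E`
  (`…LineCharactersWeilRelation.apply_mul_apply_eq_modNCyclotomicCharacter`) — no Serre line, no complex
  conjugation, no ordinarity (contrast `Rank1Residual.gvPar_of_isogeny`, whose datum mixes ramification and sign).
* §2 — along a `ℚ`-isogeny `f : E → E′` not killing `E[p]`, hence along `IsIsogenous`
  (`Rank1Residual.exists_isogeny_apply_ne_zero`: peel off factors `[p]`).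
* §3 — **the skeleton's sub-row datum VERBATIM transfers along `IsIsogenous`** (any models, no minimality):
  non-split type (`X2.IsogenyQuotientLine.hasSplitMultiplicativeReductionAtPrime_iff_of_isIsogenous`), the set `S₀`
  (`IsIsogenous.hasGoodReductionAt_iff_of_isIsogenous`, Silverman VII.7.2), `δ` (`= s_ℓ · mult(L_v mod p)`, and
  `L_v` is an isogeny invariant: `Isogeny.localPolynomialAt_eq_of_isElliptic`, Knapp 11.67), and the right-hand
  side is symmetric under the swap `(m, φ) ↔ (d, ψ)`.
* §4 — iff form and negated form: the hypothesis «¬ sub-row datum» of the registered stub is CONSTANT on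
  `ℚ`-isogeny classes; with `X2.CellB` (`…TwistbackIsogenyTransport.cellB_iff_of_isIsogenous`) and the two class
  data of v12's conclusion, the registered statement descends to X2b ISOGENY CLASSES.

References: [GreenbergVatsal2000] §2 p. 28 (`φψ = ω`), Prop. (2.4) p. 22, §3 (28) p. 42; [SilvermanAEC2009]
III.4 (Cor. III.4.11), III.8 (Weil pairing), VII.7.2, App. C §16; [SilvermanCSS1997] Ch. II §§7–8
(`det ρ̄_{E,m} = χ_m`); [Knapp1993] Thm. 11.67.
-/

set_option autoImplicit false

-- `Summit.BirchSwinnertonDyer.BirchSwinnertonDyer.…`: the summit and its single sub-problem share a name.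
set_option linter.dupNamespace false

noncomputable section

open scoped Classical

open WeierstrassCurve NumberField IsDedekindDomain Field
  Literature.NumberTheory.GaloisRepresentations Literature.NumberTheory.EllipticCurves
  Literature.NumberTheory.EllipticCurves.Rank1Residual
  Literature.NumberTheory.EllipticCurves.GreenbergVatsal2000
  Summit.BirchSwinnertonDyer.Rank1Residual
  Summit.BirchSwinnertonDyer.Rank1Residual.X2.ResidualDevissageModules
  Summit.BirchSwinnertonDyer.BirchSwinnertonDyer.Theorems.CumulativeHeegnerInclusionAtThreeStubB1LineDeterminant
  Summit.BirchSwinnertonDyer.BirchSwinnertonDyer.Theorems.EisensteinPrimesLineCharactersWeilRelation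

namespace Summit.BirchSwinnertonDyer.BirchSwinnertonDyer.Theorems.EisensteinPrimesMazurMCOnCellBTwistbackSubrowDatumIsogeny

variable {W W' : WeierstrassCurve ℚ} [W.IsElliptic] [W'.IsElliptic] {p : ℕ} [hp : Fact p.Prime]

/-! ## §1. Line-datum transfer along an equivariant `g : E[p] → E′[p]` with `ker g ≠ E[p]` -/

section Equivariant

variable (g : geomTorsion W (p : ℤ) →+ geomTorsion W' (p : ℤ))
  (hg : ∀ (σ : absoluteGaloisGroup ℚ) (P : geomTorsion W (p : ℤ)), g (σ • P) = σ • g P)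

omit [W.IsElliptic] in
/-- **The quotient character is forced by the determinant.** If `Λ ≤ E′[p]` is a rational line on which `Γ_ℚ`
acts through the Dirichlet character `α` mod `n₁` (composed with `χ_{n₁}`), and `β` mod `n₂` satisfies
`α(χ_{n₁} σ)·β(χ_{n₂} σ) = χ_p(σ)` for every `σ`, then `Γ_ℚ` acts on `E′[p]/Λ` through `β`:
`σ • Q − β(χ_{n₂} σ) • Q ∈ Λ`. (`det ρ̄_{E′,p} = χ_p`, Weil pairing, read on a frame adapted to `Λ`.)
[cite: SilvermanCSS1997, Ch. II §7 Proposition and §8 (det ρ̄_{E,m} = χ_m)] -/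
theorem smul_sub_smul_mem_of_line_of_mul_eq {Λ : AddSubgroup (geomTorsion W' (p : ℤ))}
    (hΛ : IsRationalLine W' p Λ)
    {n₁ : ℕ} [NeZero n₁] (α : DirichletCharacter (ZMod p) n₁)
    {n₂ : ℕ} [NeZero n₂] (β : DirichletCharacter (ZMod p) n₂)
    (hα : ∀ (σ : absoluteGaloisGroup ℚ), ∀ y ∈ Λ,
      σ • y = (α ((modNCyclotomicCharacter ℚ n₁ σ : (ZMod n₁)ˣ) : ZMod n₁)).val • y)
    (hαβ : ∀ σ : absoluteGaloisGroup ℚ,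
      α ((modNCyclotomicCharacter ℚ n₁ σ : (ZMod n₁)ˣ) : ZMod n₁) *
          β ((modNCyclotomicCharacter ℚ n₂ σ : (ZMod n₂)ˣ) : ZMod n₂) =
        ((modNCyclotomicCharacter ℚ p σ : (ZMod p)ˣ) : ZMod p))
    (σ : absoluteGaloisGroup ℚ) (Q : geomTorsion W' (p : ℤ)) :
    σ • Q - (β ((modNCyclotomicCharacter ℚ n₂ σ : (ZMod n₂)ˣ) : ZMod n₂)).val • Q ∈ Λ := by
  let S : StableSubgroup (absoluteGaloisGroup ℚ) (geomTorsion W' (p : ℤ)) :=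
    ⟨Λ, fun τ _ hm ↦ hΛ.2 τ _ hm⟩
  have hS : Nat.card S.Sub = p := hΛ.1
  set k : ℕ := (α ((modNCyclotomicCharacter ℚ n₁ σ : (ZMod n₁)ˣ) : ZMod n₁)).val with hk
  set k' : ℕ := (β ((modNCyclotomicCharacter ℚ n₂ σ : (ZMod n₂)ˣ) : ZMod n₂)).val with hk'
  have hkk' : (k : ZMod p) * (k' : ZMod p) = ((modNCyclotomicCharacter ℚ p σ : (ZMod p)ˣ) : ZMod p) := by
    rw [hk, hk', ZMod.natCast_zmod_val, ZMod.natCast_zmod_val, hαβ σ]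
  have hkS : ∀ x : S.Sub, σ • x = k • x := by
    intro x
    apply S.incl_injective
    rw [S.incl_smul, map_nsmul]
    exact hα σ _ x.2
  exact smul_sub_nsmul_mem_of_smul_sub_eq W' p S hS σ k k' hkk' hkS Q

omit [W'.IsElliptic] in
include hg in
/-- **The sub-character of the image line.** Given a rational line `Φ₀ ≤ E[p]` with sub-presentation `(m, φ)`
and quotient presentation `(d, ψ)`, and `g : E[p] → E′[p]` equivariant with `ker g ≠ E[p]`: there is a rational
line `Λ ≤ E′[p]` on which `Γ_ℚ` acts through `φ` (cases `ker g = 0`, or `ker g` a line `≠ Φ₀`: `Λ = g(Φ₀)`) or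
through `ψ` (case `ker g = Φ₀`: `Λ = g(E[p]) ≅ E[p]/Φ₀`). [cite: SilvermanAEC2009, III.4 (Cor. III.4.11)] -/
theorem exists_line_smul_eq_or (hker : g.ker ≠ ⊤)
    {Φ₀ : AddSubgroup (geomTorsion W (p : ℤ))} (hΦ : IsRationalLine W p Φ₀)
    {m : ℕ} [NeZero m] (φ : DirichletCharacter (ZMod p) m)
    {d : ℕ} [NeZero d] (ψ : DirichletCharacter (ZMod p) d)
    (hφ0 : ∀ (σ : absoluteGaloisGroup ℚ), ∀ P ∈ Φ₀,
      σ • P = (φ ((modNCyclotomicCharacter ℚ m σ : (ZMod m)ˣ) : ZMod m)).val • P)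
    (hψ0 : ∀ (σ : absoluteGaloisGroup ℚ) (P : geomTorsion W (p : ℤ)),
      σ • P - (ψ ((modNCyclotomicCharacter ℚ d σ : (ZMod d)ˣ) : ZMod d)).val • P ∈ Φ₀) :
    ∃ Λ : AddSubgroup (geomTorsion W' (p : ℤ)), IsRationalLine W' p Λ ∧
      ((∀ (σ : absoluteGaloisGroup ℚ), ∀ y ∈ Λ,
          σ • y = (φ ((modNCyclotomicCharacter ℚ m σ : (ZMod m)ˣ) : ZMod m)).val • y) ∨
        (∀ (σ : absoluteGaloisGroup ℚ), ∀ y ∈ Λ,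
          σ • y = (ψ ((modNCyclotomicCharacter ℚ d σ : (ZMod d)ˣ) : ZMod d)).val • y)) := by
  have hpp : p.Prime := hp.out
  have hE : Nat.card (geomTorsion W (p : ℤ)) = p ^ 2 := Rank1Residual.natCard_geomTorsion W p
  haveI : Finite (geomTorsion W (p : ℤ)) :=
    Nat.finite_of_card_ne_zero (by rw [hE]; exact pow_ne_zero 2 hpp.ne_zero)
  -- the image of `Φ₀` carries `φ` whenever `g` is injective on `Φ₀`
  have himage : (∀ P ∈ Φ₀, g P = 0 → P = 0) →
      ∃ Λ : AddSubgroup (geomTorsion W' (p : ℤ)), IsRationalLine W' p Λ ∧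
        ((∀ (σ : absoluteGaloisGroup ℚ), ∀ y ∈ Λ,
            σ • y = (φ ((modNCyclotomicCharacter ℚ m σ : (ZMod m)ˣ) : ZMod m)).val • y) ∨
          (∀ (σ : absoluteGaloisGroup ℚ), ∀ y ∈ Λ,
            σ • y = (ψ ((modNCyclotomicCharacter ℚ d σ : (ZMod d)ˣ) : ZMod d)).val • y)) := by
    intro hinj
    refine ⟨Φ₀.map g, isRationalLine_map g hg hΦ hinj, Or.inl ?_⟩
    intro σ y hy
    obtain ⟨P, hP, rfl⟩ := AddSubgroup.mem_map.mp hy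
    rw [← hg, hφ0 σ P hP, map_nsmul]
  -- `#ker g ∈ {1, p, p²}`
  have hdvd : Nat.card g.ker ∣ p ^ 2 := hE ▸ g.ker.card_addSubgroup_dvd_card
  obtain ⟨i, hi, hKi⟩ := (Nat.dvd_prime_pow hpp).mp hdvd
  interval_cases i
  · -- `ker g = ⊥`
    have hbot : g.ker = ⊥ := AddSubgroup.card_eq_one.mp (by simpa using hKi)
    refine himage fun P _ hP0 ↦ ?_
    have hmem : P ∈ g.ker := (AddMonoidHom.mem_ker).mpr hP0
    rwa [hbot, AddSubgroup.mem_bot] at hmem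
  · -- `ker g` is a line
    have hK : Nat.card g.ker = p := by simpa using hKi
    rcases line_eq_or_inf_eq_bot hΦ.1 hK with h | h
    · -- `Φ₀ = ker g`: the image `g(E[p]) ≅ E[p]/Φ₀` carries `ψ`
      refine ⟨g.range, isRationalLine_range g hg hE hK, Or.inr ?_⟩
      intro σ y hy
      obtain ⟨P, rfl⟩ := AddMonoidHom.mem_range.mp hy
      have h1 : σ • P - (ψ ((modNCyclotomicCharacter ℚ d σ : (ZMod d)ˣ) : ZMod d)).val • P ∈ g.ker :=
        h ▸ hψ0 σ P
      rw [AddMonoidHom.mem_ker, map_sub, hg, map_nsmul, sub_eq_zero] at h1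
      exact h1
    · -- `Φ₀ ⊓ ker g = ⊥`: `g` is injective on `Φ₀`
      refine himage fun P hP hP0 ↦ ?_
      have hmem : P ∈ Φ₀ ⊓ g.ker := AddSubgroup.mem_inf.mpr ⟨hP, (AddMonoidHom.mem_ker).mpr hP0⟩
      rwa [h, AddSubgroup.mem_bot] at hmem
  · -- `ker g = E[p]`: excluded
    exact absurd (AddSubgroup.eq_top_of_card_eq _ (by rw [hKi, hE])) hker

include hg in
/-- **Line-datum transfer along an equivariant `g : E[p] → E′[p]` with `ker g ≠ E[p]`.** From a rational line
`Φ₀ ≤ E[p]` with Dirichlet presentations `(m, φ)` on the line and `(d, ψ)` on the quotient, `E′[p]` carries a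
rational line `Λ` with the presentations `(m, φ), (d, ψ)` KEPT or SWAPPED: the sub-character by
`exists_line_smul_eq_or`, the quotient character by the determinant (`smul_sub_smul_mem_of_line_of_mul_eq`) and the
Weil relation `φ·ψ = χ_p` on `E` (`apply_mul_apply_eq_modNCyclotomicCharacter`). Greenberg–Vatsal p. 28: the
unordered pair `{φ, ψ}` is the semisimplification of `E[p]`, an invariant of the isogeny class.
[cite: GreenbergVatsal2000, §2 p. 28 (φψ = ω)] [cite: SilvermanCSS1997, Ch. II §7 Proposition and §8 (det ρ̄_{E,m} = χ_m)] -/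
theorem exists_lineDatum_or_swap (hker : g.ker ≠ ⊤)
    {Φ₀ : AddSubgroup (geomTorsion W (p : ℤ))} (hΦ : IsRationalLine W p Φ₀)
    {m : ℕ} [NeZero m] (φ : DirichletCharacter (ZMod p) m)
    {d : ℕ} [NeZero d] (ψ : DirichletCharacter (ZMod p) d)
    (hφ0 : ∀ (σ : absoluteGaloisGroup ℚ), ∀ P ∈ Φ₀,
      σ • P = (φ ((modNCyclotomicCharacter ℚ m σ : (ZMod m)ˣ) : ZMod m)).val • P)
    (hψ0 : ∀ (σ : absoluteGaloisGroup ℚ) (P : geomTorsion W (p : ℤ)),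
      σ • P - (ψ ((modNCyclotomicCharacter ℚ d σ : (ZMod d)ˣ) : ZMod d)).val • P ∈ Φ₀) :
    ∃ Λ : AddSubgroup (geomTorsion W' (p : ℤ)), IsRationalLine W' p Λ ∧
      (((∀ (σ : absoluteGaloisGroup ℚ), ∀ y ∈ Λ,
            σ • y = (φ ((modNCyclotomicCharacter ℚ m σ : (ZMod m)ˣ) : ZMod m)).val • y) ∧
          (∀ (σ : absoluteGaloisGroup ℚ) (Q : geomTorsion W' (p : ℤ)),
            σ • Q - (ψ ((modNCyclotomicCharacter ℚ d σ : (ZMod d)ˣ) : ZMod d)).val • Q ∈ Λ)) ∨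
        ((∀ (σ : absoluteGaloisGroup ℚ), ∀ y ∈ Λ,
            σ • y = (ψ ((modNCyclotomicCharacter ℚ d σ : (ZMod d)ˣ) : ZMod d)).val • y) ∧
          (∀ (σ : absoluteGaloisGroup ℚ) (Q : geomTorsion W' (p : ℤ)),
            σ • Q - (φ ((modNCyclotomicCharacter ℚ m σ : (ZMod m)ˣ) : ZMod m)).val • Q ∈ Λ))) := by
  have hweil := apply_mul_apply_eq_modNCyclotomicCharacter hΦ φ ψ hφ0 hψ0
  obtain ⟨Λ, hΛ, hφΛ | hψΛ⟩ := exists_line_smul_eq_or g hg hker hΦ φ ψ hφ0 hψ0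
  · exact ⟨Λ, hΛ, Or.inl ⟨hφΛ, smul_sub_smul_mem_of_line_of_mul_eq hΛ φ ψ hφΛ hweil⟩⟩
  · refine ⟨Λ, hΛ, Or.inr ⟨hψΛ, smul_sub_smul_mem_of_line_of_mul_eq hΛ ψ φ hψΛ ?_⟩⟩
    intro σ
    rw [mul_comm]
    exact hweil σ

end Equivariant

/-! ## §2. Along a `ℚ`-isogeny not killing `E[p]`, and along `IsIsogenous` -/

/-- **Line-datum transfer along a `ℚ`-isogeny `f : E → E′` with `E[p] ⊄ ker f`** (e.g. cyclic): restrict `f` to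
`E[p] → E′[p]` and apply §1. [cite: SilvermanAEC2009, III.4 (Cor. III.4.11)] -/
theorem exists_lineDatum_or_swap_of_isogeny (f : Isogeny W W')
    (hf : ∃ P : geomPoints W, P ∈ geomTorsion W (p : ℤ) ∧ f P ≠ 0)
    {Φ₀ : AddSubgroup (geomTorsion W (p : ℤ))} (hΦ : IsRationalLine W p Φ₀)
    {m : ℕ} [NeZero m] (φ : DirichletCharacter (ZMod p) m)
    {d : ℕ} [NeZero d] (ψ : DirichletCharacter (ZMod p) d)
    (hφ0 : ∀ (σ : absoluteGaloisGroup ℚ), ∀ P ∈ Φ₀,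
      σ • P = (φ ((modNCyclotomicCharacter ℚ m σ : (ZMod m)ˣ) : ZMod m)).val • P)
    (hψ0 : ∀ (σ : absoluteGaloisGroup ℚ) (P : geomTorsion W (p : ℤ)),
      σ • P - (ψ ((modNCyclotomicCharacter ℚ d σ : (ZMod d)ˣ) : ZMod d)).val • P ∈ Φ₀) :
    ∃ Λ : AddSubgroup (geomTorsion W' (p : ℤ)), IsRationalLine W' p Λ ∧
      (((∀ (σ : absoluteGaloisGroup ℚ), ∀ y ∈ Λ,
            σ • y = (φ ((modNCyclotomicCharacter ℚ m σ : (ZMod m)ˣ) : ZMod m)).val • y) ∧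
          (∀ (σ : absoluteGaloisGroup ℚ) (Q : geomTorsion W' (p : ℤ)),
            σ • Q - (ψ ((modNCyclotomicCharacter ℚ d σ : (ZMod d)ˣ) : ZMod d)).val • Q ∈ Λ)) ∨
        ((∀ (σ : absoluteGaloisGroup ℚ), ∀ y ∈ Λ,
            σ • y = (ψ ((modNCyclotomicCharacter ℚ d σ : (ZMod d)ˣ) : ZMod d)).val • y) ∧
          (∀ (σ : absoluteGaloisGroup ℚ) (Q : geomTorsion W' (p : ℤ)),
            σ • Q - (φ ((modNCyclotomicCharacter ℚ m σ : (ZMod m)ˣ) : ZMod m)).val • Q ∈ Λ))) := by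
  -- the restriction `g : E[p] →+ E′[p]` of `f`
  have hmem : ∀ P : geomTorsion W (p : ℤ), f (P : geomPoints W) ∈ geomTorsion W' (p : ℤ) := by
    intro P
    have h0 : (p : ℤ) • (P : geomPoints W) = 0 := (Submodule.mem_torsionBy_iff (p : ℤ) _).mp P.2
    have h1 : (p : ℤ) • f (P : geomPoints W) = 0 := by rw [← map_zsmul, h0, map_zero]
    exact (Submodule.mem_torsionBy_iff (p : ℤ) _).mpr h1
  let g : geomTorsion W (p : ℤ) →+ geomTorsion W' (p : ℤ) :=
    { toFun := fun P ↦ ⟨f (P : geomPoints W), hmem P⟩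
      map_zero' := Subtype.ext (by simp)
      map_add' := fun P Q ↦ Subtype.ext (by simp) }
  have hgval : ∀ P : geomTorsion W (p : ℤ), (g P : geomPoints W') = f (P : geomPoints W) :=
    fun _ ↦ rfl
  have hg : ∀ (σ : absoluteGaloisGroup ℚ) (P : geomTorsion W (p : ℤ)), g (σ • P) = σ • g P := by
    intro σ P
    apply Subtype.ext
    rw [hgval, AddSubgroup.torsionBy.coe_smul, AddSubgroup.torsionBy.coe_smul, hgval, f.map_smul]
  have hker : g.ker ≠ ⊤ := by
    intro htop
    obtain ⟨P, hP, hfP⟩ := hf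
    have hmem1 : (⟨P, hP⟩ : geomTorsion W (p : ℤ)) ∈ g.ker := by rw [htop]; exact AddSubgroup.mem_top _
    rw [AddMonoidHom.mem_ker] at hmem1
    exact hfP (by simpa [hgval] using congrArg Subtype.val hmem1)
  exact exists_lineDatum_or_swap g hg hker hΦ φ ψ hφ0 hψ0

/-- **Line-datum transfer along `IsIsogenous`**: every `ℚ`-isogenous pair is joined by an isogeny not killing
`E[p]` (`Rank1Residual.exists_isogeny_apply_ne_zero`), so the datum of §1 passes from `E` to any `E′ ∼ E` with the
two presentations kept or swapped. [cite: SilvermanAEC2009, III.4 (Cor. III.4.11)] -/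
theorem exists_lineDatum_or_swap_of_isIsogenous (h : IsIsogenous W W')
    {Φ₀ : AddSubgroup (geomTorsion W (p : ℤ))} (hΦ : IsRationalLine W p Φ₀)
    {m : ℕ} [NeZero m] (φ : DirichletCharacter (ZMod p) m)
    {d : ℕ} [NeZero d] (ψ : DirichletCharacter (ZMod p) d)
    (hφ0 : ∀ (σ : absoluteGaloisGroup ℚ), ∀ P ∈ Φ₀,
      σ • P = (φ ((modNCyclotomicCharacter ℚ m σ : (ZMod m)ˣ) : ZMod m)).val • P)
    (hψ0 : ∀ (σ : absoluteGaloisGroup ℚ) (P : geomTorsion W (p : ℤ)),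
      σ • P - (ψ ((modNCyclotomicCharacter ℚ d σ : (ZMod d)ˣ) : ZMod d)).val • P ∈ Φ₀) :
    ∃ Λ : AddSubgroup (geomTorsion W' (p : ℤ)), IsRationalLine W' p Λ ∧
      (((∀ (σ : absoluteGaloisGroup ℚ), ∀ y ∈ Λ,
            σ • y = (φ ((modNCyclotomicCharacter ℚ m σ : (ZMod m)ˣ) : ZMod m)).val • y) ∧
          (∀ (σ : absoluteGaloisGroup ℚ) (Q : geomTorsion W' (p : ℤ)),
            σ • Q - (ψ ((modNCyclotomicCharacter ℚ d σ : (ZMod d)ˣ) : ZMod d)).val • Q ∈ Λ)) ∨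
        ((∀ (σ : absoluteGaloisGroup ℚ), ∀ y ∈ Λ,
            σ • y = (ψ ((modNCyclotomicCharacter ℚ d σ : (ZMod d)ˣ) : ZMod d)).val • y) ∧
          (∀ (σ : absoluteGaloisGroup ℚ) (Q : geomTorsion W' (p : ℤ)),
            σ • Q - (φ ((modNCyclotomicCharacter ℚ m σ : (ZMod m)ˣ) : ZMod m)).val • Q ∈ Λ))) := by
  obtain ⟨f, P, hP, hfP⟩ := exists_isogeny_apply_ne_zero (p := p) h
  exact exists_lineDatum_or_swap_of_isogeny f ⟨P, hP, hfP⟩ hΦ φ ψ hφ0 hψ0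

/-! ## §3. The skeleton's sub-row datum transfers along `IsIsogenous` -/

/-- **`δ_E^{(v)}` is a `ℚ`-isogeny invariant** (`δ = s_ℓ · mult_{ℓ̄⁻¹}(L_v(E, T) mod p)` and isogenous curves have
the same local polynomial at every finite place — Knapp 11.67 / Faltings, tree `Isogeny.localPolynomialAt_eq_of_isElliptic`).
[cite: GreenbergVatsal2000, §2 Prop. (2.4) (p. 22)] [cite: Knapp1993, Thm. 11.67 (PDF p. 281)] -/
theorem delta_eq_of_isIsogenous (h : IsIsogenous W W') (q : ℕ) (v : HeightOneSpectrum (𝓞 ℚ)) :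
    delta W' q v = delta W q v := by
  obtain ⟨f⟩ := h
  unfold delta dMultiplicity eulerFactorModP
  rw [f.localPolynomialAt_eq_of_isElliptic v]

/-- **THE SUB-ROW DATUM IS A CLASS DATUM.** For `ℚ`-isogenous elliptic `W ∼ W′` (ANY models: the reduction
predicates, `δ` and `E[3]` are model-free), the sub-row datum of the
registered stub of line `twistback` (VERBATIM its first negated hypothesis, v5–v12: `p = 3`, `3` NON-split, a rational
`3`-line `Φ₀` with primitive presentations `(m, φ)` / `(d, ψ)`, a set `S₀ ∌ (3)` off which the curve is good, and the
Greenberg–Vatsal balance `1 + Σ_{S₀} δ = Σ_{S₀} (s·[φ(ℓ) = ℓ̄] + s·[ψ(ℓ) = ℓ̄])`) at `W` implies the same datum at `W′`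
— with the SAME `S₀` and the presentations kept or swapped (§2), the non-split type, the good places and `δ` being
isogeny invariants and the right-hand side symmetric in `(m, φ) ↔ (d, ψ)`. What w7 g3 kernel-checked member by member
on the 30 A10 sub-row classes (46/46), for every `ℚ`-isogeny class.
[cite: GreenbergVatsal2000, §3 Thm. (3.11) and (28) p. 42] [cite: SilvermanAEC2009, Cor. VII.7.2] -/
theorem subrowDatum_of_isIsogenous (h : IsIsogenous W W') (q : ℕ)
    (hD : q = 3 ∧ ¬ W.HasSplitMultiplicativeReductionAtPrime 3 ∧
      ∃ (Φ₀ : AddSubgroup (geomTorsion W (3 : ℤ))) (m : ℕ) (_ : NeZero m) (φ : DirichletCharacter (ZMod 3) m)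
        (d : ℕ) (_ : NeZero d) (ψ : DirichletCharacter (ZMod 3) d) (S₀ : Finset (HeightOneSpectrum (𝓞 ℚ))),
        IsRationalLine W 3 Φ₀ ∧ φ.IsPrimitive ∧ ψ.IsPrimitive ∧
        (∀ (σ : absoluteGaloisGroup ℚ), ∀ P ∈ Φ₀,
          σ • P = (φ ((modNCyclotomicCharacter ℚ m σ : (ZMod m)ˣ) : ZMod m)).val • P) ∧
        (∀ (σ : absoluteGaloisGroup ℚ) (P : geomTorsion W (3 : ℤ)),
          σ • P - (ψ ((modNCyclotomicCharacter ℚ d σ : (ZMod d)ˣ) : ZMod d)).val • P ∈ Φ₀) ∧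
        (∀ v ∈ S₀, ((3 : ℕ) : 𝓞 ℚ) ∉ v.asIdeal) ∧
        (∀ v : HeightOneSpectrum (𝓞 ℚ), v ∉ S₀ → ((3 : ℕ) : 𝓞 ℚ) ∉ v.asIdeal → W.HasGoodReductionAt v) ∧
        1 + ∑ v ∈ S₀, delta W 3 v =
          ∑ v ∈ S₀, ((if φ (Rat.HeightOneSpectrum.natGenerator v : ZMod m) =
                (Rat.HeightOneSpectrum.natGenerator v : ZMod 3)
              then sFactor 3 (Rat.HeightOneSpectrum.natGenerator v) else 0) +
            (if ψ (Rat.HeightOneSpectrum.natGenerator v : ZMod d) =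
                (Rat.HeightOneSpectrum.natGenerator v : ZMod 3)
              then sFactor 3 (Rat.HeightOneSpectrum.natGenerator v) else 0))) :
    q = 3 ∧ ¬ W'.HasSplitMultiplicativeReductionAtPrime 3 ∧
      ∃ (Φ₀ : AddSubgroup (geomTorsion W' (3 : ℤ))) (m : ℕ) (_ : NeZero m) (φ : DirichletCharacter (ZMod 3) m)
        (d : ℕ) (_ : NeZero d) (ψ : DirichletCharacter (ZMod 3) d) (S₀ : Finset (HeightOneSpectrum (𝓞 ℚ))),
        IsRationalLine W' 3 Φ₀ ∧ φ.IsPrimitive ∧ ψ.IsPrimitive ∧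
        (∀ (σ : absoluteGaloisGroup ℚ), ∀ P ∈ Φ₀,
          σ • P = (φ ((modNCyclotomicCharacter ℚ m σ : (ZMod m)ˣ) : ZMod m)).val • P) ∧
        (∀ (σ : absoluteGaloisGroup ℚ) (P : geomTorsion W' (3 : ℤ)),
          σ • P - (ψ ((modNCyclotomicCharacter ℚ d σ : (ZMod d)ˣ) : ZMod d)).val • P ∈ Φ₀) ∧
        (∀ v ∈ S₀, ((3 : ℕ) : 𝓞 ℚ) ∉ v.asIdeal) ∧
        (∀ v : HeightOneSpectrum (𝓞 ℚ), v ∉ S₀ → ((3 : ℕ) : 𝓞 ℚ) ∉ v.asIdeal → W'.HasGoodReductionAt v) ∧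
        1 + ∑ v ∈ S₀, delta W' 3 v =
          ∑ v ∈ S₀, ((if φ (Rat.HeightOneSpectrum.natGenerator v : ZMod m) =
                (Rat.HeightOneSpectrum.natGenerator v : ZMod 3)
              then sFactor 3 (Rat.HeightOneSpectrum.natGenerator v) else 0) +
            (if ψ (Rat.HeightOneSpectrum.natGenerator v : ZMod d) =
                (Rat.HeightOneSpectrum.natGenerator v : ZMod 3)
              then sFactor 3 (Rat.HeightOneSpectrum.natGenerator v) else 0)) := by
  obtain ⟨hq, hns, Φ₀, m, _, φ, d, _, ψ, S₀, hΦ, hφ, hψ, hφ0, hψ0, hS3, hgood, hbal⟩ := hD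
  -- the isogeny invariants: non-split type, good places, `δ`
  have hns' : ¬ W'.HasSplitMultiplicativeReductionAtPrime 3 := fun hs ↦
    hns ((X2.IsogenyQuotientLine.hasSplitMultiplicativeReductionAtPrime_iff_of_isIsogenous h).mpr hs)
  have hgood' : ∀ v : HeightOneSpectrum (𝓞 ℚ), v ∉ S₀ → ((3 : ℕ) : 𝓞 ℚ) ∉ v.asIdeal →
      W'.HasGoodReductionAt v :=
    fun v hv h3 ↦ (h.hasGoodReductionAt_iff_of_isIsogenous v).mp (hgood v hv h3)
  have hδ : ∑ v ∈ S₀, delta W' 3 v = ∑ v ∈ S₀, delta W 3 v :=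
    Finset.sum_congr rfl fun v _ ↦ delta_eq_of_isIsogenous h 3 v
  refine ⟨hq, hns', ?_⟩
  -- the line datum, kept or swapped
  obtain ⟨Λ, hΛ, ⟨hφΛ, hψΛ⟩ | ⟨hψΛ, hφΛ⟩⟩ := exists_lineDatum_or_swap_of_isIsogenous h hΦ φ ψ hφ0 hψ0
  · refine ⟨Λ, m, inferInstance, φ, d, inferInstance, ψ, S₀, hΛ, hφ, hψ, hφΛ, hψΛ, hS3, hgood', ?_⟩
    rw [hδ, hbal]
  · refine ⟨Λ, d, inferInstance, ψ, m, inferInstance, φ, S₀, hΛ, hψ, hφ, hψΛ, hφΛ, hS3, hgood', ?_⟩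
    rw [hδ, hbal]
    exact Finset.sum_congr rfl fun v _ ↦ add_comm _ _

/-! ## §4. Iff form and the negated hypothesis of the registered stub -/

/-- **Iff form**: the sub-row datum holds at `W` iff it holds at any `W′ ∼ W` (§3 both ways, the dual
isogeny `IsIsogenous.symm_of_charZero`). [cite: GreenbergVatsal2000, §3 Thm. (3.11) and (28) p. 42]
[cite: SilvermanAEC2009, Thm. III.6.1 (dual isogeny)] -/
theorem subrowDatum_iff_of_isIsogenous (h : IsIsogenous W W') (q : ℕ) :
    (q = 3 ∧ ¬ W.HasSplitMultiplicativeReductionAtPrime 3 ∧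
      ∃ (Φ₀ : AddSubgroup (geomTorsion W (3 : ℤ))) (m : ℕ) (_ : NeZero m) (φ : DirichletCharacter (ZMod 3) m)
        (d : ℕ) (_ : NeZero d) (ψ : DirichletCharacter (ZMod 3) d) (S₀ : Finset (HeightOneSpectrum (𝓞 ℚ))),
        IsRationalLine W 3 Φ₀ ∧ φ.IsPrimitive ∧ ψ.IsPrimitive ∧
        (∀ (σ : absoluteGaloisGroup ℚ), ∀ P ∈ Φ₀,
          σ • P = (φ ((modNCyclotomicCharacter ℚ m σ : (ZMod m)ˣ) : ZMod m)).val • P) ∧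
        (∀ (σ : absoluteGaloisGroup ℚ) (P : geomTorsion W (3 : ℤ)),
          σ • P - (ψ ((modNCyclotomicCharacter ℚ d σ : (ZMod d)ˣ) : ZMod d)).val • P ∈ Φ₀) ∧
        (∀ v ∈ S₀, ((3 : ℕ) : 𝓞 ℚ) ∉ v.asIdeal) ∧
        (∀ v : HeightOneSpectrum (𝓞 ℚ), v ∉ S₀ → ((3 : ℕ) : 𝓞 ℚ) ∉ v.asIdeal → W.HasGoodReductionAt v) ∧
        1 + ∑ v ∈ S₀, delta W 3 v =
          ∑ v ∈ S₀, ((if φ (Rat.HeightOneSpectrum.natGenerator v : ZMod m) =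
                (Rat.HeightOneSpectrum.natGenerator v : ZMod 3)
              then sFactor 3 (Rat.HeightOneSpectrum.natGenerator v) else 0) +
            (if ψ (Rat.HeightOneSpectrum.natGenerator v : ZMod d) =
                (Rat.HeightOneSpectrum.natGenerator v : ZMod 3)
              then sFactor 3 (Rat.HeightOneSpectrum.natGenerator v) else 0))) ↔
    (q = 3 ∧ ¬ W'.HasSplitMultiplicativeReductionAtPrime 3 ∧
      ∃ (Φ₀ : AddSubgroup (geomTorsion W' (3 : ℤ))) (m : ℕ) (_ : NeZero m) (φ : DirichletCharacter (ZMod 3) m)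
        (d : ℕ) (_ : NeZero d) (ψ : DirichletCharacter (ZMod 3) d) (S₀ : Finset (HeightOneSpectrum (𝓞 ℚ))),
        IsRationalLine W' 3 Φ₀ ∧ φ.IsPrimitive ∧ ψ.IsPrimitive ∧
        (∀ (σ : absoluteGaloisGroup ℚ), ∀ P ∈ Φ₀,
          σ • P = (φ ((modNCyclotomicCharacter ℚ m σ : (ZMod m)ˣ) : ZMod m)).val • P) ∧
        (∀ (σ : absoluteGaloisGroup ℚ) (P : geomTorsion W' (3 : ℤ)),
          σ • P - (ψ ((modNCyclotomicCharacter ℚ d σ : (ZMod d)ˣ) : ZMod d)).val • P ∈ Φ₀) ∧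
        (∀ v ∈ S₀, ((3 : ℕ) : 𝓞 ℚ) ∉ v.asIdeal) ∧
        (∀ v : HeightOneSpectrum (𝓞 ℚ), v ∉ S₀ → ((3 : ℕ) : 𝓞 ℚ) ∉ v.asIdeal → W'.HasGoodReductionAt v) ∧
        1 + ∑ v ∈ S₀, delta W' 3 v =
          ∑ v ∈ S₀, ((if φ (Rat.HeightOneSpectrum.natGenerator v : ZMod m) =
                (Rat.HeightOneSpectrum.natGenerator v : ZMod 3)
              then sFactor 3 (Rat.HeightOneSpectrum.natGenerator v) else 0) +
            (if ψ (Rat.HeightOneSpectrum.natGenerator v : ZMod d) =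
                (Rat.HeightOneSpectrum.natGenerator v : ZMod 3)
              then sFactor 3 (Rat.HeightOneSpectrum.natGenerator v) else 0))) :=
  ⟨subrowDatum_of_isIsogenous h q, subrowDatum_of_isIsogenous h.symm_of_charZero q⟩

end Summit.BirchSwinnertonDyer.BirchSwinnertonDyer.Theorems.EisensteinPrimesMazurMCOnCellBTwistbackSubrowDatumIsogeny

end
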